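import Mathlib.Geometry.Manifold.ContMDiff.NormedSpace
import Literature.Geometry.Symplectic.JHolomorphicMap
import HarnessLib

/-!
# `J`-holomorphic maps: the differential is complex linear; holomorphic reparametrisation

Topic `Literature/Geometry/Symplectic`; small API for the tree's `J`-holomorphic maps
`Literature.Geometry.Symplectic.IsJHolomorphic I J u` (`JHolomorphicMap.lean`: `u : ℂ → M` with
`du_z(iζ) = J_{u z}(du_z ζ)`, Hummel (1997), Ch. I §3, eq. (3.1); McDuff–Salamon (2017), §4.5,
(4.5.1)), written for the fact seat of
`Literature.Geometry.Symplectic.Eliashberg1990_steinFilling_sphere_three` (holomorphic discs are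
used up to reparametrisation of the source throughout Eliashberg (1990), §2–§5) and for the
entire-curve items of route `SmoothPoincare4/SullivanDual`.  Everything is proved; no definition,
no named fact.

* `IsJHolomorphic.mfderiv_apply_eq` — **`du_z` is determined by `u_x = du_z 1`**:
  `du_z ζ = (Re ζ) du_z 1 + (Im ζ) J du_z 1` (`du_z` is complex linear for the structure `J_{u z}`
  on the target, Hummel's "`T_p f` is complex linear");
* `fderiv_real_apply_I_mul` — for `g : ℂ → ℂ` complex differentiable at `z`,
  `Dg_z(iζ) = i Dg_z(ζ)` (real Fréchet derivative = restriction of scalars of the complex one);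
* `IsJHolomorphic.comp_of_differentiable` — **holomorphic reparametrisation**: if `u` is
  `J`-holomorphic and differentiable and `g : ℂ → ℂ` is complex differentiable, then `u ∘ g` is
  `J`-holomorphic (chain rule: `d(u∘g)_z(iζ) = du(Dg(iζ)) = du(i Dg ζ) = J du(Dg ζ)`);
* `IsJHolomorphic.comp_affine`, `IsEntireJCurve.comp_affine` — in particular under the affine
  maps `z ↦ a z + b` (`a ≠ 0` for entire curves, which must stay non-constant).

## References

* C. Hummel, *Gromov's Compactness Theorem for Pseudo-holomorphic Curves*, Progress in Math.
  151 (1997), Ch. I §3, Definition and eq. (3.1). [Hummel1997]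
* D. McDuff, D. Salamon, *Introduction to Symplectic Topology*, 3rd ed. (2017), §4.5,
  eq. (4.5.1). [McDuffSalamon2017]
-/

noncomputable section

open scoped Manifold ContDiff Topology
open Set

namespace Literature.Geometry.Symplectic

/-! ### The real derivative of a complex-differentiable map commutes with `i` -/

/-- For `g : ℂ → ℂ` complex differentiable at `z`, the real Fréchet derivative commutes with
multiplication by `i`: `Dg_z(iζ) = i Dg_z(ζ)` (it is the restriction of scalars of the
`ℂ`-linear `fderiv ℂ g z`). [folklore] -/
theorem fderiv_real_apply_I_mul {g : ℂ → ℂ} {z : ℂ} (hg : DifferentiableAt ℂ g z) (ζ : ℂ) :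
    fderiv ℝ g z (Complex.I * ζ) = Complex.I * fderiv ℝ g z ζ := by
  rw [hg.fderiv_restrictScalars ℝ]
  simp only [ContinuousLinearMap.coe_restrictScalars']
  rw [← smul_eq_mul, ContinuousLinearMap.map_smul, smul_eq_mul]

section Manifold

variable {E : Type*} [NormedAddCommGroup E] [NormedSpace ℝ E] {H : Type*} [TopologicalSpace H]
  {I : ModelWithCorners ℝ E H} {M : Type*} [TopologicalSpace M] [ChartedSpace H M]
  {J : ∀ x : M, TangentSpace I x →L[ℝ] TangentSpace I x} {u : ℂ → M}

namespace IsJHolomorphic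

/-- **The differential of a `J`-holomorphic map is complex linear**: it is determined by
`u_x = du_z 1` through `du_z ζ = (Re ζ) • du_z 1 + (Im ζ) • J (du_z 1)` (write
`ζ = Re ζ + (Im ζ) i` and use `du_z(i) = J du_z(1)`; Hummel (1997), Ch. I §3: "`T_p f` is complex
linear for each `p`"). [cite: Hummel1997, Ch. I §3, Definition and eq. (3.1)] -/
theorem mfderiv_apply_eq (hJ : IsJHolomorphic I J u) (z ζ : ℂ) :
    mfderiv 𝓘(ℝ, ℂ) I u z ζ =
      (ζ.re : ℝ) • mfderiv 𝓘(ℝ, ℂ) I u z (1 : ℂ) + (ζ.im : ℝ) • J (u z) (mfderiv 𝓘(ℝ, ℂ) I u z (1 : ℂ)) := by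
  have hdec : ζ = (ζ.re : ℝ) • (1 : ℂ) + (ζ.im : ℝ) • (Complex.I * 1 : ℂ) := by
    rw [mul_one, Complex.real_smul, Complex.real_smul, mul_one, Complex.re_add_im]
  -- stated for a plain real-linear `L : ℂ →L[ℝ] E` (the tangent spaces are `ℂ` and `E`)
  have key : ∀ (L : ℂ →L[ℝ] E) (j : E →L[ℝ] E), L (Complex.I * 1) = j (L 1) →
      L ζ = (ζ.re : ℝ) • L 1 + (ζ.im : ℝ) • j (L 1) := by
    intro L j h
    conv_lhs => rw [hdec]
    rw [map_add, map_smul, map_smul, h]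
  exact key _ _ (hJ z 1)

/-- **Holomorphic reparametrisation of the source preserves `J`-holomorphicity.**  If `u : ℂ → M`
is `J`-holomorphic and differentiable at the points `g z`, and `g : ℂ → ℂ` is complex
differentiable, then `u ∘ g` is `J`-holomorphic:
`d(u ∘ g)_z(iζ) = du_{g z}(Dg_z(iζ)) = du_{g z}(i Dg_z ζ) = J du_{g z}(Dg_z ζ) = J d(u ∘ g)_z ζ`.
(Hummel (1997), Ch. I §3: `j`-`J`-holomorphic maps compose with holomorphic maps of the source.)
[cite: Hummel1997, Ch. I §3, Definition and eq. (3.1)] -/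
theorem comp_of_differentiable (hJ : IsJHolomorphic I J u) {g : ℂ → ℂ} (hg : Differentiable ℂ g)
    (hu : ∀ z, MDifferentiableAt 𝓘(ℝ, ℂ) I u (g z)) : IsJHolomorphic I J (u ∘ g) := by
  intro z ζ
  have hg' : HasMFDerivAt 𝓘(ℝ, ℂ) 𝓘(ℝ, ℂ) g z ((fderiv ℂ g z).restrictScalars ℝ) :=
    ((hg z).hasFDerivAt.restrictScalars ℝ).hasMFDerivAt
  rw [((hu z).hasMFDerivAt.comp z hg').mfderiv]
  have e1 : ((fderiv ℂ g z).restrictScalars ℝ) (Complex.I * ζ) = Complex.I * fderiv ℂ g z ζ := by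
    simp only [ContinuousLinearMap.coe_restrictScalars']
    rw [← smul_eq_mul, ContinuousLinearMap.map_smul, smul_eq_mul]
  calc ((mfderiv 𝓘(ℝ, ℂ) I u (g z)).comp ((fderiv ℂ g z).restrictScalars ℝ)) (Complex.I * ζ)
        = mfderiv 𝓘(ℝ, ℂ) I u (g z) (Complex.I * fderiv ℂ g z ζ) :=
          congrArg (mfderiv 𝓘(ℝ, ℂ) I u (g z)) e1
    _ = J (u (g z)) (mfderiv 𝓘(ℝ, ℂ) I u (g z) (fderiv ℂ g z ζ)) := hJ (g z) _
    _ = J ((u ∘ g) z)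
          (((mfderiv 𝓘(ℝ, ℂ) I u (g z)).comp ((fderiv ℂ g z).restrictScalars ℝ)) ζ) := rfl

/-- **Affine reparametrisation**: `z ↦ u (a z + b)` is `J`-holomorphic when `u` is
`J`-holomorphic and differentiable. [cite: Hummel1997, Ch. I §3, Definition and eq. (3.1)] -/
theorem comp_affine (hJ : IsJHolomorphic I J u) (hu : MDifferentiable 𝓘(ℝ, ℂ) I u) (a b : ℂ) :
    IsJHolomorphic I J (u ∘ fun z => a * z + b) :=
  hJ.comp_of_differentiable ((differentiable_id.const_mul a).add_const b) fun _ => hu _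

end IsJHolomorphic

/-- **Affine reparametrisation of an entire `J`-curve** (`a ≠ 0`): `z ↦ u (a z + b)` is again a
non-constant `C^∞` entire `J`-curve. [cite: Hummel1997, Ch. I §3, Definition] -/
theorem IsEntireJCurve.comp_affine (h : IsEntireJCurve I J u) {a : ℂ} (ha : a ≠ 0) (b : ℂ) :
    IsEntireJCurve I J (u ∘ fun z => a * z + b) := by
  have hg : ContMDiff 𝓘(ℝ, ℂ) 𝓘(ℝ, ℂ) ∞ (fun z : ℂ => a * z + b) :=
    contMDiff_iff_contDiff.2 ((contDiff_const.mul contDiff_id).add contDiff_const)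
  refine ⟨h.contMDiff.comp hg, ?_, h.isJHolomorphic.comp_affine
    (fun z => (h.contMDiff z).mdifferentiableAt (by simp)) a b⟩
  obtain ⟨z, z', hne⟩ := h.exists_ne
  refine ⟨a⁻¹ * (z - b), a⁻¹ * (z' - b), ?_⟩
  simp only [Function.comp_apply]
  rwa [← mul_assoc, mul_inv_cancel₀ ha, one_mul, sub_add_cancel, ← mul_assoc,
    mul_inv_cancel₀ ha, one_mul, sub_add_cancel]

end Manifold

end Literature.Geometry.Symplectic
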